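/- Copyright: the b2b-balaban cell (near-miss cell 7), T⁴-continuum fan-out; row NE7b OWNER lineage `t4-ne7b-p1`
(gen 60) — «(d2′) ON THE COUNT SIDE: THE CHAIN CLOCK IS BOOKED», part 1 of 2 (kernel item of RULING R-OWNER-60-1).
Released under the licence of the surrounding project. -/
import Summits.QuantumFields.BalabanUV.T4Continuum.Support.HistoryWindows
import Summits.QuantumFields.BalabanUV.T4Continuum.Support.HistoryReadinessChainScale

/-!
# History windows ON PRINT's CHAIN CLOCK (`StopAtC`): the birth and join lifetime bounds of the index model hold with
the SAME constants as the tree clock's (row NE7b, R-OWNER-60-1, part 1 of 2; part 2 = `HistoryReadinessChainRealise`)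

Summits-side support leaf of the T⁴-continuum cell (rung (B)+1 on a FINITE torus only; NOT infinite volume, NOT the
mass gap, NOT the Clay statement; NOT a proof of the spine estimate NE7b — the cell's OWN estimate, NOT PRINTED, NOT
PROVED).  [folklore] finite combinatorics in the ℤᵈ INDEX MODEL of the operation `S` (Literature `B16SProfile`,
`B16StoppingRule`, `B16MergeGeometry`, `B16MergeHorizon`, `TreeLength*`, all [K]) over row S1b's `HistoryWindows` and
the owner's g59 companion `HistoryReadinessChainScale` (`StopAtC := StopAt ∧ CondI (X (K − N))`); no `[cite:]` tag, no
`def` at all (hence no `Prop` fact of Bałaban's minted), zero `sorry`.  B15 = [Balaban1989LargeFieldI] p. 179 and B16 =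
[Balaban1989LargeFieldII] pp. 384–387 are manuscripts UNDER AUDIT and appear only as LOCATORS of which index set is
modelled.

WHY (ruling R-OWNER-59-1 and its located rider (d2′); memo `HOME/t4/b2b-balaban-t4-ne7b-p1/g59/D5-FORK-READ.md` v1.4).
Gen 59 read the 𝐑-operation of [B15] §1 as acting on a nested chain of single boxes with a member at EVERY scale
`h, h + 1, …, k`, `h = k − N` (p. 179 «for j = h, h + 1, …, k»; p. 195 «Λ ⊃ Z″_k ⊃ ⋯ ⊃ Z″_{h+1} ⊃ (Ω″^{~2}_{h+1})^c»), so
print-constructible readiness is the `N + 1`-scale predicate `StopAtC`, one (i)-test more than the tree's `StopAt`, and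
booked the difference as «census-neutral» IN PROSE.  The COUNT's lifetime budget is the window table `dictW` (birth
`fatWait d′ + R_j + 1`, renewal `R_s + 1`, join `n₁ + R_s`), whose three physical bounds `HistoryWindows` proves for
the TREE clock.  Neutrality is NOT automatic: a chain-stop may come one level after a tree-stop
(`HistoryReadinessChainScale.stopAtC_succ_of_stopAt`; in the model condition (i) can fail at the scale after an
(i)-scale across a no-gain step — `HistoryWindows.condI_from_add_two`'s «99 + 20 = 119»), while the birth and renewal
windows carry EXACTLY one level of slack.  THIS FILE proves the birth and join bounds FOR THE CHAIN CLOCK with the tree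
clock's constants: BIRTH `k ≤ fatWait d′ + N` (§2: below the top threshold the chain's bottom is the first small
scale `i₀ + 1`; AT the top threshold `i₀ = fatWait d′` the scaling property `½·d′_{i₀} ≤ (½)^{i₀}·d′_j(Z)`
(`B16SProfile.half_pow_mul_treeLen_ge`) with `d′ < 2^{fatWait d′ + 1}` forces the cover's tree length `< 4` at `i₀`,
hence condition (i) THERE); JOIN `k ≤ max K₁ K₂ + 13 + N` with `13`, not `14` (§3: a chain-stop carries TWO CONSECUTIVE
(i)-scales `K − 1, K` — §1 —, so a partner's (i) is available from its index MINUS ONE and `B16MergeHorizon.condI_merge`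
runs one index lower, absorbing the chain's extra level even in the symmetric case `K₁ = K₂`; a partner chain-stopped
one scale after the join is (i)-small AT the join scale and goes through `condI_union` with `D = 100`).  The renewal
bound and the realisation theorem are part 2.

WHAT.  §1 `condI_pred_of_stopAtC`, `condI_from_pair`, `condI_from_stopAtC`.  §2 `lt_two_pow_fatWait_succ`,
`treeLen_lt_four_at_fatWait`, `condI_of_treeLen_lt_four`, **`stopAtC_birth`**.  §3 `stopAtC_join_aux`, **`stopAtC_join`**.

HONEST SCOPE.  Index-model combinatorics on hypothesis shapes; nothing of Bałaban's asserted, instantiated or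
discharged; the cell's process of record (clock `StopsM`) is NOT edited; census NONE; R∕T rows by count UNCHANGED.
NE7b NOT PRINTED ∕ NOT PROVED; spine 0∕9.  HONEST DEPENDENCY (cell): continuum YM on T⁴ ⇐ BetaPertH ∧ nine spine
estimates (0/9 proved); BetaPertH ⇐ (D1) ∧ (D4) ∧ CAP+tail; G-an2-4 gates asym, D1 and NE2/3/4.  This file changes
none of it.
-/

open Finset
open Literature.MathematicalPhysics.QuantumFieldTheory.Balaban1983to89
open Literature.MathematicalPhysics.QuantumFieldTheory.Balaban1983to89.B13ScaleTransfer
open Literature.MathematicalPhysics.QuantumFieldTheory.Balaban1983to89.TreeLength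
open Literature.MathematicalPhysics.QuantumFieldTheory.Balaban1983to89.B16SProfile
open Literature.MathematicalPhysics.QuantumFieldTheory.Balaban1983to89.B16StoppingRule
open Literature.MathematicalPhysics.QuantumFieldTheory.Balaban1983to89.B16Absorption
open Literature.MathematicalPhysics.QuantumFieldTheory.Balaban1983to89.B16MergeGeometry
open Literature.MathematicalPhysics.QuantumFieldTheory.Balaban1983to89.B16MergeHorizon
open T4PersistenceDictionary
open Summit.QuantumFields.BalabanUV.T4Continuum.HistoryWindows
open Summit.QuantumFields.BalabanUV.T4Continuum.HistoryReadinessChainScale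

namespace Summit.QuantumFields.BalabanUV.T4Continuum.HistoryReadinessChainWindows

noncomputable section

variable {d : ℕ}

/-! ## §1 A chain-stop carries two consecutive (i)-scales, hence (i) at every later scale -/

/-- below a chain-stop at `K` (memory `N ≥ 1`) condition (i) holds at `K − 1`: it is a window scale when `N ≥ 2` and
the chain's extra bottom scale `K − N` when `N = 1`. [folklore] -/
theorem condI_pred_of_stopAtC {Nsz N : ℕ} {Clean : ℕ → Prop} {X : ℕ → Finset (Pt d)} {K : ℕ} (hN : 1 ≤ N)
    (h : StopAtC Nsz N Clean X K) : CondI Nsz (X (K - 1)) := by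
  obtain ⟨⟨hK, -, hNK, hall⟩, hlow⟩ := h
  rcases Nat.lt_or_ge 1 N with h1 | h1
  · exact (hall (K - 1) (by omega) (by omega)).2
  · obtain rfl : N = 1 := le_antisymm h1 hN
    exact hlow

/-- **TWO CONSECUTIVE (i)-SCALES PERSIST**: along an iterate sequence of the flow (`L ≥ 3`, drop control on the horizon
`m`), condition (i) at `K − 1` and at `K` (`K ≥ 1`) gives condition (i) at EVERY scale `l ≥ K − 1` of the horizon
(`HistoryWindows.condI_from_add_two` from `K − 1` covers `l ≥ K + 1`). [folklore] -/
theorem condI_from_pair {L : ℕ} (hL : 3 ≤ L) {σ : ℕ → ℕ} {m : ℕ} (hσ : DropCtl σ m) {X : ℕ → Finset (Pt d)}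
    (hX : ∀ l, X (l + 1) = Sop (ratio L σ l) (X l)) {K : ℕ} (hK : 0 < K) (h1 : CondI 100 (X (K - 1)))
    (h2 : CondI 100 (X K)) : ∀ l, K - 1 ≤ l → l ≤ m → CondI 100 (X l) := by
  intro l hl hlm
  rcases (show l = K - 1 ∨ l = K ∨ K - 1 + 2 ≤ l by omega) with rfl | rfl | h3
  · exact h1
  · exact h2
  · exact condI_from_add_two hL hσ hX h1 l h3 hlm

/-- **(i) AT EVERY SCALE FROM A CHAIN-STOP ON** (and one before): a chain-stop at `K` with memory `N ≥ 1` gives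
condition (i) at every `l ≥ K − 1` of the horizon. [folklore] -/
theorem condI_from_stopAtC {L : ℕ} (hL : 3 ≤ L) {σ : ℕ → ℕ} {m : ℕ} (hσ : DropCtl σ m) {X : ℕ → Finset (Pt d)}
    (hX : ∀ l, X (l + 1) = Sop (ratio L σ l) (X l)) {N : ℕ} (hN : 1 ≤ N) {Clean : ℕ → Prop} {K : ℕ}
    (h : StopAtC 100 N Clean X K) : ∀ l, K - 1 ≤ l → l ≤ m → CondI 100 (X l) :=
  condI_from_pair hL hσ hX h.1.1 (condI_pred_of_stopAtC hN h) h.1.2.1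

/-! ## §2 Birth: condition (i) at the fat threshold itself when the threshold is `fatWait d′` -/

/-- the class is below `2^{fatWait d′ + 1}` (`fatWait d′ = max 1 ⌊log₂ d′⌋`). [folklore] -/
theorem lt_two_pow_fatWait_succ (cls : ℕ) : cls < 2 ^ (fatWait cls + 1) := by
  have h1 : cls < 2 ^ (Nat.log 2 cls + 1) := Nat.lt_pow_succ_log_self one_lt_two cls
  have h2 : 2 ^ (Nat.log 2 cls + 1) ≤ 2 ^ (fatWait cls + 1) :=
    Nat.pow_le_pow_right (by norm_num) (by unfold fatWait; omega)
  omega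

/-- **AT THE INDEX `fatWait d′` THE COVER's TREE LENGTH IS `< 4`**: by the scaling property
`½·d′_i(Z^{(i)}) ≤ (½)^i·d′_j(Z)` (`i ≥ 1`, `L ≥ 4`, drop control) and `d′_j(Z) ≤ d′ < 2^{fatWait d′ + 1}`. [folklore] -/
theorem treeLen_lt_four_at_fatWait {L : ℕ} {σ : ℕ → ℕ} {m : ℕ} (hL : 4 ≤ L) (hσ : DropCtl σ m)
    {Z : Finset (Pt d)} (hZ : Z.Nonempty) (hZc : FaceConnected Z) {cls : ℕ} (hcls : treeLen Z ≤ cls)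
    (hm : fatWait cls ≤ m) : treeLen (closureIdx (Qprod (ratio L σ) (fatWait cls)) Z) < 4 := by
  have hi1 : 1 ≤ fatWait cls := le_max_left _ _
  have hh := half_pow_mul_treeLen_ge hL hσ hZ hZc hi1 hm
  have hcls' : (cls : ℝ) < 2 ^ (fatWait cls + 1) := by exact_mod_cast lt_two_pow_fatWait_succ cls
  have hkey : (1 / 2 : ℝ) ^ fatWait cls * 2 ^ (fatWait cls + 1) = 2 := by
    rw [pow_succ, ← mul_assoc, ← mul_pow]; norm_num
  have hpos : (0 : ℝ) < (1 / 2) ^ fatWait cls := by positivity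
  have hlt : (1 / 2 : ℝ) ^ fatWait cls * treeLen Z < (1 / 2) ^ fatWait cls * 2 ^ (fatWait cls + 1) :=
    lt_of_le_of_lt (mul_le_mul_of_nonneg_left hcls hpos.le) (mul_lt_mul_of_pos_left hcls' hpos)
  linarith

/-- **TREE LENGTH `< 4` ⇒ CONDITION (i)**: if the cover `Z^{(i)}` has tree length `< 4`, no two of its cubes are `5`
apart in a coordinate (`B16MergeGeometry.sub_one_le_treeLen_of_apart`), so they lie within `4` of the least one,
and `S^{i}(Z) ⊆ ⋃_{□ ⊂ Z^{(i)}} □^{~31}` (`B16SProfile.Siter_subset_biUnion_box`, `L ≥ 3`, drop control) fits in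
`31 + 4 + 31 + 1 = 67 ≤ 100` cubes per side. [folklore] -/
theorem condI_of_treeLen_lt_four {L : ℕ} {σ : ℕ → ℕ} {m i : ℕ} (hL : 3 ≤ L) (hσ : DropCtl σ m)
    {Z : Finset (Pt d)} (hZ : Z.Nonempty) (hZc : FaceConnected Z) (hi : i ≤ m)
    (ht : treeLen (closureIdx (Qprod (ratio L σ) i) Z) < 4) :
    CondI 100 (Siter (ratio L σ) i Z) := by
  set C := closureIdx (Qprod (ratio L σ) i) Z with hC
  have hCne : C.Nonempty := closureIdx_nonempty hZ
  have hCc : FaceConnected C :=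
    faceConnected_closureIdx (Qprod_pos (fun l => ratio_pos (by omega) σ l) i) hZc
  obtain ⟨T, hT, -⟩ := exists_admissible hCne hCc
  have hadm : ∃ T, Admissible C T := ⟨T, hT⟩
  -- no two cubes of the cover are five apart in a coordinate
  have hnear : ∀ x ∈ C, ∀ y ∈ C, ∀ μ, y μ ≤ x μ + 4 := by
    intro x hx y hy μ
    by_contra hcon
    have h5 : x μ + ((5 : ℕ) : ℤ) ≤ y μ := by push_cast; omega
    have h := sub_one_le_treeLen_of_apart hadm hx hy (by norm_num) h5
    norm_num at h
    linarith
  have hsub := Siter_subset_biUnion_box hL hσ Z hi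
  apply condI_of_boxed
  refine ⟨fun μ => C.inf' hCne (fun x => x μ) - 31, fun μ => C.inf' hCne (fun x => x μ) + 35, ?_,
    fun μ => by dsimp only; omega⟩
  intro y hy
  obtain ⟨c, hc, hyc⟩ := Finset.mem_biUnion.mp (hsub hy)
  rw [mem_pbox]
  intro μ
  have h1 := (mem_box.mp hyc) μ
  obtain ⟨c', hc', hc'eq⟩ := Finset.exists_mem_eq_inf' hCne (fun x : Pt d => x μ)
  have h2 : C.inf' hCne (fun x => x μ) ≤ c μ := Finset.inf'_le _ hc
  have h3 := hnear c' hc' c hc μ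
  rw [hc'eq] at h2 ⊢
  constructor <;> omega

/-- **BIRTH ON THE CHAIN CLOCK: «K ≤ n₀ − j + R_j» STILL.**  For a non-empty face-connected region `Z` of class
`d′ ≥ treeLen Z` (`L ≥ 4`, drop control on a horizon `m ≥ fatWait d′ + N`, memory `N ≥ 1`, the steps after the birth
clean), the CHAIN stopping property holds at some `1 ≤ k ≤ fatWait d′ + N` — the same bound as the tree clock's
(`HistoryWindows.stopAt_birth`): below the top threshold the chain's bottom is the first small scale `i₀ + 1`; at the top
threshold `i₀ = fatWait d′` condition (i) holds AT `i₀` (`treeLen_lt_four_at_fatWait` + `condI_of_treeLen_lt_four`).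
[folklore] -/
theorem stopAtC_birth {N L : ℕ} {σ : ℕ → ℕ} {m : ℕ} (hN : 1 ≤ N) (hL : 4 ≤ L) (hσ : DropCtl σ m)
    {Z : Finset (Pt d)} (hZ : Z.Nonempty) (hZc : FaceConnected Z) {cls : ℕ} (hcls : treeLen Z ≤ cls)
    (Clean : ℕ → Prop) (hclean : ∀ l, 1 ≤ l → l ≤ m → Clean l) (hm : fatWait cls + N ≤ m) :
    ∃ k, 1 ≤ k ∧ k ≤ fatWait cls + N ∧ StopAtC 100 N Clean (fun i => Siter (ratio L σ) i Z) k := by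
  have hL3 : 3 ≤ L := by omega
  obtain ⟨i₀, hi₀m, hA, hB⟩ := exists_threshold (show 0 < L by omega) σ m hZ hZc
  have hi₀ : i₀ ≤ fatWait cls := by
    rcases Nat.eq_zero_or_pos i₀ with h0 | hpos
    · omega
    · exact threshold_le_fatWait hL hσ hZ hZc hcls hi₀m (hA i₀ hpos le_rfl)
  rcases hi₀.lt_or_eq with hlt | heq
  · -- chain bottom at the first small scale `i₀ + 1`
    refine ⟨i₀ + 1 + N, by omega, by omega, ?_, ?_⟩
    · exact stopAt_threshold (by norm_num) hN hL3 hσ hZ hZc (i₀ + 1) (fun i hi him => hB i (by omega) him) Clean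
        hclean (by omega)
    · show CondI 100 (Siter (ratio L σ) (i₀ + 1 + N - N) Z)
      rw [Nat.add_sub_cancel]
      exact condI_of_lt_one hL3 hσ hZ hZc (by omega) (hB _ (by omega) (by omega))
  · -- top threshold: condition (i) at `i₀ = fatWait d′` itself
    refine ⟨i₀ + N, by omega, by omega, ?_, ?_⟩
    · exact stopAt_threshold (by norm_num) hN hL3 hσ hZ hZc i₀ hB Clean hclean (by omega)
    · show CondI 100 (Siter (ratio L σ) (i₀ + N - N) Z)
      rw [Nat.add_sub_cancel, heq]
      exact condI_of_treeLen_lt_four hL3 hσ hZ hZc (by omega) (treeLen_lt_four_at_fatWait hL hσ hZ hZc hcls (by omega))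

/-! ## §3 Join: «K ≤ K₂ + n₁ + R_{j+1}» STILL, with `n₁ = 13` -/

/-- one-sided join bound (partner `X` with the smaller index): see `stopAtC_join`. [folklore] -/
theorem stopAtC_join_aux {L : ℕ} (hL : 2 ≤ L) {σ : ℕ → ℕ} {m' : ℕ} (hσ : DropCtl σ m')
    {X Y : Finset (Pt d)} {a c : Pt d} (ha : a ∈ X) (hc : c ∈ Y) (hac : Touch a c)
    {K₁ K₂ : ℕ} (hK₁ : 1 ≤ K₁) (h12 : K₁ ≤ K₂)
    (hXI : ∀ m, K₁ - 1 ≤ m → CondI 100 (Siter (ratio L σ) m X))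
    (hYI : ∀ m, K₂ - 1 ≤ m → CondI 100 (Siter (ratio L σ) m Y))
    {N : ℕ} (Clean : ℕ → Prop) (hclean : ∀ l, 1 ≤ l → l ≤ m' → Clean l) (hm : K₂ + 13 + N ≤ m') :
    ∃ k, 1 ≤ k ∧ k ≤ K₂ + 13 + N ∧ StopAtC 100 N Clean (fun l => Siter (ratio L σ) l (X ∪ Y)) k := by
  -- a scale `m₀ ≤ K₂ + 13` from which the union satisfies (i) on the horizon
  obtain ⟨m₀, hm₀1, hm₀, hU⟩ : ∃ m₀, 1 ≤ m₀ ∧ m₀ ≤ K₂ + 13 ∧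
      ∀ mm, m₀ ≤ mm → mm ≤ m' → CondI 100 (Siter (ratio L σ) mm (X ∪ Y)) := by
    rcases Nat.lt_or_ge 1 K₁ with h2 | h2
    · -- `K₁ ≥ 2`: merge at the partner index `K₁ − 1 ≥ 1`
      refine ⟨max (K₂ + 6) (K₁ - 1 + 14), by omega, by omega, fun mm h1 h2' => ?_⟩
      exact condI_merge hL hσ ha hc hac (K₁ := K₁ - 1) (K₂ := K₂) (by omega) (by omega) (hXI (K₁ - 1) le_rfl)
        (hYI K₂ (by omega)) (by omega) (by omega) h2'
    · -- `K₁ = 1`: `X` is (i)-small AT the join scale, within `100` of the cube `c` of `Y`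
      have hX0 : CondI 100 X := by simpa using hXI 0 (by omega)
      have hnear := near_of_condI_touch hX0 ha hac
      refine ⟨max (K₂ + 6) 14, by omega, by omega, fun mm h1 h2' => ?_⟩
      exact condI_union hL hσ hc (D := 100) (by norm_num) (by norm_num) hnear (s := K₂) (hYI K₂ (by omega))
        (by omega) (by omega) h2'
  refine ⟨m₀ + N, by omega, by omega, ⟨by omega, hU _ (by omega) (by omega), by omega,
    fun l h1 h2 => ⟨hclean l (by omega) (by omega), hU l (by omega) (by omega)⟩⟩, ?_⟩
  show CondI 100 (Siter (ratio L σ) (m₀ + N - N) (X ∪ Y))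
  rw [Nat.add_sub_cancel]
  exact hU m₀ le_rfl (by omega)

/-- **THE JOIN CHAIN-STOPS WITHIN `max K₁ K₂ + 13 + N`.**  Two domains at the join scale, touching (`a ∈ X`, `c ∈ Y`,
`Touch a c`), each satisfying condition (i) at every scale from ITS OWN INDEX MINUS ONE on (`K₁, K₂ ≥ 1` — what a
partner's chain-stop supplies, §1), along the common flow (`L ≥ 2`, drop control on the horizon `m′`); memory `N`,
the steps after the join clean: the union has the CHAIN stopping property at some `1 ≤ k ≤ max K₁ K₂ + 13 + N` — the
tree clock's bound (`HistoryWindows.stopAt_join`), the chain's extra level absorbed by merging one index lower.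
[folklore] -/
theorem stopAtC_join {L : ℕ} (hL : 2 ≤ L) {σ : ℕ → ℕ} {m' : ℕ} (hσ : DropCtl σ m')
    {X Y : Finset (Pt d)} {a c : Pt d} (ha : a ∈ X) (hc : c ∈ Y) (hac : Touch a c)
    {K₁ K₂ : ℕ} (hK₁ : 1 ≤ K₁) (hK₂ : 1 ≤ K₂)
    (hXI : ∀ m, K₁ - 1 ≤ m → CondI 100 (Siter (ratio L σ) m X))
    (hYI : ∀ m, K₂ - 1 ≤ m → CondI 100 (Siter (ratio L σ) m Y))
    {N : ℕ} (Clean : ℕ → Prop) (hclean : ∀ l, 1 ≤ l → l ≤ m' → Clean l)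
    (hm : max K₁ K₂ + 13 + N ≤ m') :
    ∃ k, 1 ≤ k ∧ k ≤ max K₁ K₂ + 13 + N ∧ StopAtC 100 N Clean (fun l => Siter (ratio L σ) l (X ∪ Y)) k := by
  rcases le_total K₁ K₂ with h12 | h21
  · obtain ⟨k, hk1, hk, hstop⟩ :=
      stopAtC_join_aux hL hσ ha hc hac hK₁ h12 hXI hYI Clean hclean (by rw [max_eq_right h12] at hm; exact hm)
    exact ⟨k, hk1, by rw [max_eq_right h12]; exact hk, hstop⟩
  · obtain ⟨k, hk1, hk, hstop⟩ :=
      stopAtC_join_aux hL hσ hc ha hac.symm hK₂ h21 hYI hXI Clean hclean (by rw [max_eq_left h21] at hm; exact hm)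
    refine ⟨k, hk1, by rw [max_eq_left h21]; exact hk, ?_⟩
    simpa only [union_comm] using hstop

end

end Summit.QuantumFields.BalabanUV.T4Continuum.HistoryReadinessChainWindows
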